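import Literature.NumberTheory.LFunctions.Zhang2022.NumericsSection12

/-!
# Zhang (2022) §12, p.72: kernel certificates of the window displays and of (12.14)–(12.15) in the linearised reading (num lane N-07/N-08)

Trunk T-ANT (NumberTheory/LFunctions). Companion of `NumericsSection12.lean` (certified-numerics lane of the
siegel-zhang campaign, rows N-07/N-08, writer sz-num-5; Y. Zhang, arXiv:2211.02515v1 [Zhang2022LandauSiegel],
§12 — **an unrefereed manuscript under adjudication; nothing here is a statement about its theorems or about
Landau–Siegel zeros**). Split off for the 400-line cap.

`NumericsSection12` REFUTES the printed pointwise `ε`-bounds of Lemmas 12.1/12.3 in the kernel and TYPES what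
the manuscript actually consumes: the two p.72 window displays [tex L3624, L3639], the per-`j` bracket (12.14)
and the assembly (12.15)–(12.17), each as a `Prop` parametrised by a reading `w` of `𝔴_j(P^z)`. This file PROVES,
for the author's own LINEARISED reading `w = wLin` (`𝔴_j ↦ −1 + (3−j)πi(z−0.496)`, exact `𝔣𝔣` profiles kept):

* `p72a_lin_one/two/three : P72a_num wLin j` — `|∫_{0.496}^{0.498}𝔣𝔣_{j6}(0.498−z)𝔴_j dz + 0.002| < 10⁻⁶`
  (values `3.3·10⁻⁹, 3.3·10⁻⁹, 3.0·10⁻⁸`);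
* `p72b_lin_one/two/three : P72b_num wLin j` — `|∫_{0.496}^{0.5}𝔣𝔣_{j7}(0.5−z)𝔴_j dz + 0.004 + πi/250²| < 10⁻⁶`
  (values `6.05·10⁻⁷, 6.05·10⁻⁷, 3.95·10⁻⁷`);
* `eq1214_lin_one/two/three : Eq1214_num wLin j` — the (12.14) bracket within `ε/4 = 2.5·10⁻⁶`
  (values `2.11·10⁻⁶, 2.11·10⁻⁶, 1.37·10⁻⁶`);
* `eq1215_lin : Eq1215_num wLin` — the window value of `e₂*` within `ε/2 = 5·10⁻⁶` of the printed `e₂*`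
  (value `4.64·10⁻⁶`).

So, read the way the author computes them, the p.72 displays and (12.14)–(12.15) HOLD in the kernel, while the
pointwise lemma statements they are nominally derived from are false (factor 5.9–65): the defect of §12 is a
mis-stated pointwise bound, not a wrong consumed number. (The EXACT main-value reading `w = wExact` — `𝔴_j =
−D_j` as the proof of Lemma 12.3 has it — is kit-certified only, see the docstrings in `NumericsSection12`: there the
second display misses `10⁻⁶` by 1.53× at `j = 1` and (12.14)₁ misses `ε/4` by 2.4×, while (12.16), (12.17) still hold.)

**Method.** `ffF_reflect_lin` writes `𝔣𝔣_{a,k}(L−z)(−1 + bπiz)` as (quadratic)·`e^{−kπiz}`, so each window integral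
is an `expQuadInt` of `Section8ClosedForm` (`integral_ffF_lin`, after the shift `z ↦ z − 0.496`, `I6_lin_shift`);
the values are then boxed in the fixed-point interval engine `Literature.Analysis.ValidatedNumerics` (scale `2⁴⁸`,
`WlinB`, `D6B`, `D7B`, `ZDB`, `E15B`, soundness by the engine's `mem` lemmas) and the kernel evaluates the `normSq`
endpoint comparisons (`cert12W`, `cert12Z`, `decide +kernel`). Lineage 2 (kit job j247240, mpmath.iv / Arb) agrees
to all printed digits.
-/

noncomputable section

open Complex Real ComplexConjugate
open Literature.Analysis.ValidatedNumerics.Numerics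

namespace Literature.NumberTheory.LFunctions.Zhang2022.Numerics

open Literature.NumberTheory.LFunctions.Zhang2022

/-! ### Kernel certificates of the LINEARISED p.72 window displays -/

/-- Weighted reflection: `𝔣𝔣_{a,k}(c − z)·(−1 + bπiz) = e^{kπic}·(q₀ + q₁z + q₂z²)·e^{−kπiz}` with
`q₀ = −(1 + aπic)`, `q₁ = (1 + aπic)bπi + aπi`, `q₂ = abπ²`. [cite: Zhang2022LandauSiegel, (8.13)-(8.18) with section 12 p.72] -/
theorem ffF_reflect_lin (a k b : ℚ) (c z : ℝ) :
    ffF a k (c - z) * (-1 + b * π * I * z) = cexp (k * π * I * c) *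
      (((-((1 : ℂ) + a * π * I * c)) + (((1 : ℂ) + a * π * I * c) * (b * π * I) + a * π * I) * z
        + (a * b * π ^ 2 : ℂ) * ((z : ℂ) * z)) * cexp (((-k : ℚ) : ℂ) * π * I * z)) := by
  rw [ffF_reflect]
  push_cast
  have hI : I * I = -1 := Complex.I_mul_I
  ring_nf
  rw [Complex.I_sq]
  ring

/-- Closed form of the linearised window integral `∫₀ᴸ 𝔣𝔣_{a,k}(L − z)(−1 + bπiz)dz` (`k ≠ 0`). [cite: Zhang2022LandauSiegel, section 12 p.72 (tex L3624, L3639)] -/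
def WlinVal (a k b L : ℚ) : ℂ :=
  cexp ((((k : ℝ) * L * π : ℝ) : ℂ) * I) *
    expQuadInt (-((1 : ℂ) + a * π * I * ((L : ℝ) : ℂ))) (((1 : ℂ) + a * π * I * ((L : ℝ) : ℂ)) * (b * π * I) + a * π * I)
      (a * b * π ^ 2) (-k) L

/-- `∫₀ᴸ 𝔣𝔣_{a,k}(L − z)(−1 + bπiz)dz = WlinVal a k b L` (`k ≠ 0`). [cite: Zhang2022LandauSiegel, section 12 p.72 (tex L3624, L3639)] -/
theorem integral_ffF_lin (a k b L : ℚ) (hk : k ≠ 0) :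
    ∫ z in (0:ℝ)..(L : ℝ), ffF a k ((L : ℝ) - z) * (-1 + b * π * I * z) = WlinVal a k b L := by
  rw [intervalIntegral.integral_congr (fun z _ => ffF_reflect_lin a k b (L : ℝ) z),
    intervalIntegral.integral_const_mul, integral_quad_mul_cexp _ _ _ (neg_ne_zero.mpr hk)]
  have eS : cexp ((k : ℂ) * π * I * ((L : ℝ) : ℂ)) = cexp ((((k : ℝ) * L * π : ℝ) : ℂ) * I) := by
    congr 1; push_cast; ring
  rw [eS]
  rfl

/-- `I6 wLin j` shifted to `[0, 0.002]`: `= ∫₀^{0.002} 𝔣𝔣_{j6}(0.002 − x)(−1 + (3−j)πix)dx`. [cite: Zhang2022LandauSiegel, section 12 p.72 (tex L3624)] -/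
theorem I6_lin_shift (j : ℕ) :
    I6 wLin j = ∫ x in (0:ℝ)..(((1/500 : ℚ)) : ℝ), ffj6 j ((((1/500 : ℚ)) : ℝ) - x) * (-1 + ((3 - j : ℚ) : ℂ) * π * I * x) := by
  unfold I6 wLin
  have h := intervalIntegral.integral_comp_add_right
    (fun z : ℝ => ffj6 j (0.498 - z) * (-1 + (3 - (j : ℂ)) * π * I * (z - 0.496))) (0.496 : ℝ) (a := 0) (b := 0.002)
  have e1 : (0 : ℝ) + 0.496 = 0.496 := by norm_num
  have e2 : (0.002 : ℝ) + 0.496 = 0.498 := by norm_num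
  rw [e1, e2] at h
  rw [← h]
  have eL : ((((1/500 : ℚ)) : ℝ)) = 0.002 := by norm_num
  rw [eL]
  refine intervalIntegral.integral_congr (fun x _ => ?_)
  have e3 : (0.498 : ℝ) - (x + 0.496) = 0.002 - x := by ring
  simp only [e3]
  push_cast
  ring

/-- `I7 wLin j` shifted to `[0, 0.004]`. [cite: Zhang2022LandauSiegel, section 12 p.72 (tex L3639)] -/
theorem I7_lin_shift (j : ℕ) :
    I7 wLin j = ∫ x in (0:ℝ)..(((1/250 : ℚ)) : ℝ), ffj7 j ((((1/250 : ℚ)) : ℝ) - x) * (-1 + ((3 - j : ℚ) : ℂ) * π * I * x) := by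
  unfold I7 wLin
  have h := intervalIntegral.integral_comp_add_right
    (fun z : ℝ => ffj7 j (0.5 - z) * (-1 + (3 - (j : ℂ)) * π * I * (z - 0.496))) (0.496 : ℝ) (a := 0) (b := 0.004)
  have e1 : (0 : ℝ) + 0.496 = 0.496 := by norm_num
  have e2 : (0.004 : ℝ) + 0.496 = 0.5 := by norm_num
  rw [e1, e2] at h
  rw [← h]
  have eL : ((((1/250 : ℚ)) : ℝ)) = 0.004 := by norm_num
  rw [eL]
  refine intervalIntegral.integral_congr (fun x _ => ?_)
  have e3 : (0.5 : ℝ) - (x + 0.496) = 0.004 - x := by ring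
  simp only [e3]
  push_cast
  ring

/-- `I6 wLin 1 = WlinVal (1/2) (3/2) 2 (1/500)`, etc.: the six linearised window integrals in closed form. [cite: Zhang2022LandauSiegel, section 12 p.72 (tex L3624)] -/
theorem I6_lin_eq_one : I6 wLin 1 = WlinVal (1/2) (3/2) 2 (1/500) := by
  rw [I6_lin_shift, ← integral_ffF_lin _ _ _ _ (by norm_num)]
  refine intervalIntegral.integral_congr (fun x _ => ?_); simp only [ffj6, ff16]; push_cast; ring_nf
/-- see `I6_lin_eq_one` [cite: Zhang2022LandauSiegel, section 12 p.72 (tex L3624)] -/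
theorem I6_lin_eq_two : I6 wLin 2 = WlinVal (-1/2) (3/2) 1 (1/500) := by
  rw [I6_lin_shift, ← integral_ffF_lin _ _ _ _ (by norm_num)]
  refine intervalIntegral.integral_congr (fun x _ => ?_); simp only [ffj6, ff26]; push_cast; ring_nf
/-- see `I6_lin_eq_one` [cite: Zhang2022LandauSiegel, section 12 p.72 (tex L3624)] -/
theorem I6_lin_eq_three : I6 wLin 3 = WlinVal (-3/2) (3/2) 0 (1/500) := by
  rw [I6_lin_shift, ← integral_ffF_lin _ _ _ _ (by norm_num)]
  refine intervalIntegral.integral_congr (fun x _ => ?_); simp only [ffj6, ff36]; push_cast; ring_nf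
/-- see `I6_lin_eq_one` [cite: Zhang2022LandauSiegel, section 12 p.72 (tex L3639)] -/
theorem I7_lin_eq_one : I7 wLin 1 = WlinVal (3/2) (5/2) 2 (1/250) := by
  rw [I7_lin_shift, ← integral_ffF_lin _ _ _ _ (by norm_num)]
  refine intervalIntegral.integral_congr (fun x _ => ?_); simp only [ffj7, ff17]; push_cast; ring_nf
/-- see `I6_lin_eq_one` [cite: Zhang2022LandauSiegel, section 12 p.72 (tex L3639)] -/
theorem I7_lin_eq_two : I7 wLin 2 = WlinVal (1/2) (5/2) 1 (1/250) := by
  rw [I7_lin_shift, ← integral_ffF_lin _ _ _ _ (by norm_num)]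
  refine intervalIntegral.integral_congr (fun x _ => ?_); simp only [ffj7, ff27]; push_cast; ring_nf
/-- see `I6_lin_eq_one` [cite: Zhang2022LandauSiegel, section 12 p.72 (tex L3639)] -/
theorem I7_lin_eq_three : I7 wLin 3 = WlinVal (-1/2) (5/2) 0 (1/250) := by
  rw [I7_lin_shift, ← integral_ffF_lin _ _ _ _ (by norm_num)]
  refine intervalIntegral.integral_congr (fun x _ => ?_); simp only [ffj7, ff37]; push_cast; ring_nf

/-! ### Boxes for the linearised window integrals and the kernel check of the p.72 displays -/

/- Keep the interval primitives opaque to the elaborator's unifier (as in `Section8Certificate`). -/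
attribute [local irreducible] CB.add CB.sub CB.mul CB.neg CB.conj CB.mulFI CB.mulI CB.mulInt
  CB.ofFI CB.ofInt CB.normSqFI CB.expI FI.add FI.sub FI.mul FI.neg FI.mulInt FI.divNat FI.divPos
  FI.ofRat FI.ofInt FI.pi qCB piMul expIpi overPiFI piISq

/-- box mirror of `WlinVal` [cite: Zhang2022LandauSiegel, section 12 p.72] -/
@[irreducible] def WlinB (a k b L : ℚ) : CB :=
  (expIpi (k * L)).mul
    (expQuadIntB ((shiftUB a L).neg)
      (((shiftUB a L).mul (((qCB b).mulFI FI.pi).mulI)).add (((qCB a).mulFI FI.pi).mulI))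
      ((qCB (a * b)).mulFI (FI.pi.mul FI.pi)) (-k) L)

/-- `WlinVal a k b L ∈ WlinB a k b L` (given the three engine flags). [cite: Zhang2022LandauSiegel, section 12 p.72] -/
theorem mem_WlinB {a k b L : ℚ} (h1 : expIpiOK (k * L) = true) (h2 : expIpiOK (-k * L) = true)
    (h3 : overPiOK (-k)⁻¹ = true) : CB.mem (WlinVal a k b L) (WlinB a k b L) := by
  have hq0 : CB.mem (-((1 : ℂ) + a * π * I * ((L : ℝ) : ℂ))) (shiftUB a L).neg := CB.mem_neg (mem_shiftUB a L)
  have hq1 : CB.mem (((1 : ℂ) + a * π * I * ((L : ℝ) : ℂ)) * (b * π * I) + a * π * I)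
      (((shiftUB a L).mul (((qCB b).mulFI FI.pi).mulI)).add (((qCB a).mulFI FI.pi).mulI)) := by
    apply_rules [CB.mem_add, CB.mem_mul, CB.mem_mulI, CB.mem_mulFI, mem_shiftUB, mem_qCB, FI.mem_pi]
  have hq2 : CB.mem ((a : ℂ) * b * π ^ 2) ((qCB (a * b)).mulFI (FI.pi.mul FI.pi)) := by
    have e : ((a : ℂ) * b * π ^ 2) = ((a * b : ℚ) : ℂ) * (((π * π : ℝ)) : ℂ) := by push_cast; ring
    rw [e]; apply_rules [CB.mem_mulFI, mem_qCB, FI.mem_mul, FI.mem_pi]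
  have he := mem_expIpi h1
  have e2 : cexp (((((k * L : ℚ)) : ℝ) * π : ℝ) * I) = cexp ((((k : ℝ) * L * π : ℝ) : ℂ) * I) := by
    congr 1; push_cast; ring
  rw [e2] at he
  unfold WlinVal WlinB
  exact CB.mem_mul he (mem_expQuadIntB hq0 hq1 hq2 h2 h3)

/-- box of `I6 wLin j − (−0.002)` for `𝔣𝔣_{j6} = 𝔣𝔣_{a,3/2}`, `b = 3 − j` [cite: Zhang2022LandauSiegel, section 12 p.72 (tex L3624)] -/
@[irreducible] def D6B (a b : ℚ) : CB := (WlinB a (3/2) b (1/500)).add (qCB (1/500))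
/-- box of `I7 wLin j − (−0.004 − πi/250²)` for `𝔣𝔣_{j7} = 𝔣𝔣_{a,5/2}`, `b = 3 − j` [cite: Zhang2022LandauSiegel, section 12 p.72 (tex L3639)] -/
@[irreducible] def D7B (a b : ℚ) : CB :=
  ((WlinB a (5/2) b (1/250)).add (qCB (1/250))).add ((((CB.ofFI FI.pi).mulI)).mulFI (FI.ofRat (1/62500)))

/-- `W − (−0.002) ∈ D6B` from `W ∈ WlinB`. [cite: Zhang2022LandauSiegel, section 12 p.72 (tex L3624)] -/
theorem mem_D6B {a b : ℚ} {W : ℂ} (hW : CB.mem W (WlinB a (3/2) b (1/500))) :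
    CB.mem (W - (-0.002)) (D6B a b) := by
  have e : W - (-0.002) = W + ((1/500 : ℚ) : ℂ) := by push_cast; ring
  rw [e]; unfold D6B; exact CB.mem_add hW (mem_qCB _)

/-- `W − (−0.004 − πi/250²) ∈ D7B` from `W ∈ WlinB`. [cite: Zhang2022LandauSiegel, section 12 p.72 (tex L3639)] -/
theorem mem_D7B {a b : ℚ} {W : ℂ} (hW : CB.mem W (WlinB a (5/2) b (1/250))) :
    CB.mem (W - (-0.004 - π * I / 250 ^ 2)) (D7B a b) := by
  have e : W - (-0.004 - π * I / 250 ^ 2) = W + ((1/250 : ℚ) : ℂ) + (π : ℂ) * I * (((1/62500 : ℚ) : ℝ) : ℂ) := by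
    push_cast; ring
  rw [e]; unfold D7B
  apply_rules [CB.mem_add, CB.mem_mulFI, CB.mem_mulI, mem_piCB, FI.mem_ofRat, mem_qCB]

/-- From `normSq z < 10⁻¹²`: `‖z‖ < 10⁻⁶`. [folklore] -/
private theorem norm_lt_of_normSq_lt6 {z : ℂ} (h : Complex.normSq z < ((1/10^12 : ℚ) : ℝ)) : ‖z‖ < 1 / 10 ^ 6 := by
  have h0 : 0 ≤ ‖z‖ := norm_nonneg z
  rw [Complex.normSq_eq_norm_sq] at h
  have h2 : ((1/10^12 : ℚ) : ℝ) = (1 / 10 ^ 6) ^ 2 := by norm_num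
  rw [h2] at h
  exact lt_of_pow_lt_pow_left₀ 2 (by norm_num) h

/-- The certificate comparisons for the six linearised window displays: `normSq < 10⁻¹²·2⁴⁸`. [cite: Zhang2022LandauSiegel, section 12 p.72 (tex L3624, L3639)] -/
def CertProp12W : Prop :=
  (((D6B (1/2) 2).normSqFI.hi : ℚ) < (1/10^12 : ℚ) * (SC : ℚ)) ∧ (((D6B (-1/2) 1).normSqFI.hi : ℚ) < (1/10^12 : ℚ) * (SC : ℚ))
  ∧ (((D6B (-3/2) 0).normSqFI.hi : ℚ) < (1/10^12 : ℚ) * (SC : ℚ))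
  ∧ (((D7B (3/2) 2).normSqFI.hi : ℚ) < (1/10^12 : ℚ) * (SC : ℚ)) ∧ (((D7B (1/2) 1).normSqFI.hi : ℚ) < (1/10^12 : ℚ) * (SC : ℚ))
  ∧ (((D7B (-1/2) 0).normSqFI.hi : ℚ) < (1/10^12 : ℚ) * (SC : ℚ))

/-- Decidability of the certificate comparisons. [folklore] -/
instance : Decidable CertProp12W := by unfold CertProp12W; infer_instance

/-- **The kernel check** (window displays). [cite: Zhang2022LandauSiegel, section 12 p.72 (tex L3624, L3639)] -/
theorem cert12W : CertProp12W := by decide +kernel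

/-- engine flags for `k = 3/2`, `L = 1/500` [cite: Zhang2022LandauSiegel, section 12 p.72] -/
theorem flags6 : expIpiOK (3/2 * (1/500)) = true ∧ expIpiOK (-(3/2) * (1/500)) = true ∧ overPiOK (-(3/2 : ℚ))⁻¹ = true := by
  refine ⟨?_, ?_, ?_⟩ <;> decide +kernel
/-- engine flags for `k = 5/2`, `L = 1/250` [cite: Zhang2022LandauSiegel, section 12 p.72] -/
theorem flags7 : expIpiOK (5/2 * (1/250)) = true ∧ expIpiOK (-(5/2) * (1/250)) = true ∧ overPiOK (-(5/2 : ℚ))⁻¹ = true := by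
  refine ⟨?_, ?_, ?_⟩ <;> decide +kernel

/-- **p.72 first display, linearised reading, `j = 1`**: `|∫𝔣𝔣₁₆(0.498−z)𝔴₁dz + 0.002| < 10⁻⁶` (value `3.3·10⁻⁹`). [cite: Zhang2022LandauSiegel, section 12 p.72 (tex L3624)] -/
theorem p72a_lin_one : P72a_num wLin 1 := by
  unfold P72a_num; rw [I6_lin_eq_one]
  exact norm_lt_of_normSq_lt6 (hi_bound (CB.mem_normSqFI (mem_D6B (mem_WlinB flags6.1 flags6.2.1 flags6.2.2))) cert12W.1)
/-- **p.72 first display, linearised, `j = 2`** (value `3.3·10⁻⁹`). [cite: Zhang2022LandauSiegel, section 12 p.72 (tex L3624)] -/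
theorem p72a_lin_two : P72a_num wLin 2 := by
  unfold P72a_num; rw [I6_lin_eq_two]
  exact norm_lt_of_normSq_lt6 (hi_bound (CB.mem_normSqFI (mem_D6B (mem_WlinB flags6.1 flags6.2.1 flags6.2.2))) cert12W.2.1)
/-- **p.72 first display, linearised, `j = 3`** (value `3.0·10⁻⁸`). [cite: Zhang2022LandauSiegel, section 12 p.72 (tex L3624)] -/
theorem p72a_lin_three : P72a_num wLin 3 := by
  unfold P72a_num; rw [I6_lin_eq_three]
  exact norm_lt_of_normSq_lt6 (hi_bound (CB.mem_normSqFI (mem_D6B (mem_WlinB flags6.1 flags6.2.1 flags6.2.2))) cert12W.2.2.1)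
/-- **p.72 second display, linearised, `j = 1`**: `|∫𝔣𝔣₁₇(0.5−z)𝔴₁dz + 0.004 + πi/250²| < 10⁻⁶` (value `6.05·10⁻⁷`). [cite: Zhang2022LandauSiegel, section 12 p.72 (tex L3639)] -/
theorem p72b_lin_one : P72b_num wLin 1 := by
  unfold P72b_num; rw [I7_lin_eq_one]
  exact norm_lt_of_normSq_lt6 (hi_bound (CB.mem_normSqFI (mem_D7B (mem_WlinB flags7.1 flags7.2.1 flags7.2.2))) cert12W.2.2.2.1)
/-- **p.72 second display, linearised, `j = 2`** (value `6.05·10⁻⁷`). [cite: Zhang2022LandauSiegel, section 12 p.72 (tex L3639)] -/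
theorem p72b_lin_two : P72b_num wLin 2 := by
  unfold P72b_num; rw [I7_lin_eq_two]
  exact norm_lt_of_normSq_lt6 (hi_bound (CB.mem_normSqFI (mem_D7B (mem_WlinB flags7.1 flags7.2.1 flags7.2.2))) cert12W.2.2.2.2.1)
/-- **p.72 second display, linearised, `j = 3`** (value `3.95·10⁻⁷`). [cite: Zhang2022LandauSiegel, section 12 p.72 (tex L3639)] -/
theorem p72b_lin_three : P72b_num wLin 3 := by
  unfold P72b_num; rw [I7_lin_eq_three]
  exact norm_lt_of_normSq_lt6 (hi_bound (CB.mem_normSqFI (mem_D7B (mem_WlinB flags7.1 flags7.2.1 flags7.2.2))) cert12W.2.2.2.2.2)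

/-! ### (12.14) per `j` and (12.15), linearised reading, in the kernel -/

/-- `Z_j − bracket = (ῑ₃/0.498)(I6 + 0.002) + 2ῑ₄(I7 + 0.004 + πi/250²)`. [cite: Zhang2022LandauSiegel, (12.13)-(12.14)] -/
theorem Z1214_sub_bracket (w : ℕ → ℝ → ℂ) (j : ℕ) :
    Z1214 w j - bracket1214 = conj iota3 * (((500/249 : ℚ) : ℝ) : ℂ) * (I6 w j - (-0.002))
      + conj iota4 * 2 * (I7 w j - (-0.004 - π * I / 250 ^ 2)) := by
  unfold Z1214 bracket1214
  push_cast
  ring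

/-- box of `Z_j − bracket` (linearised reading; `a₆ = 3/2 − j`, `a₇ = 5/2 − j`, `b = 3 − j`) [cite: Zhang2022LandauSiegel, (12.14)] -/
@[irreducible] def ZDB (a6 a7 b : ℚ) : CB :=
  ((iota3B.conj.mulFI (FI.ofRat (500/249))).mul (D6B a6 b)).add ((iota4B.conj.mulInt 2).mul (D7B a7 b))

/-- `Z_j − bracket ∈ ZDB` given the two window values in their boxes. [cite: Zhang2022LandauSiegel, (12.14)] -/
theorem mem_ZDB {a6 a7 b : ℚ} {w : ℕ → ℝ → ℂ} {j : ℕ}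
    (h6 : CB.mem (I6 w j) (WlinB a6 (3/2) b (1/500))) (h7 : CB.mem (I7 w j) (WlinB a7 (5/2) b (1/250))) :
    CB.mem (Z1214 w j - bracket1214) (ZDB a6 a7 b) := by
  rw [Z1214_sub_bracket]; unfold ZDB
  have h2 : CB.mem (conj iota4 * 2) (iota4B.conj.mulInt 2) := by
    simpa using CB.mem_mulInt (CB.mem_conj mem_iota4) 2
  exact CB.mem_add (CB.mem_mul (CB.mem_mulFI (CB.mem_conj mem_iota3) (FI.mem_ofRat _)) (mem_D6B h6))
    (CB.mem_mul h2 (mem_D7B h7))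

/-- `e₂* = (4/(0.504π))·bracket1214` (definitional reading of `Section18Defs.e2star`). [cite: Zhang2022LandauSiegel, (12.14)-(12.15)] -/
theorem e2star_eq_bracket : e2star = ((4 / (0.504 * π) : ℝ) : ℂ) * bracket1214 := rfl

/-- `e2starW w − e₂* = (125/63)/π · ((Z₁−br)/2 + 2(Z₂−br) + 3(Z₃−br)/2)` (weights sum to 4; box-friendly order). [cite: Zhang2022LandauSiegel, (12.15)] -/
theorem e2starW_sub (w : ℕ → ℝ → ℂ) :
    e2starW w - e2star = ((overPi (125/63) : ℝ) : ℂ) *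
      ((Z1214 w 1 - bracket1214) * (((1/2 : ℚ) : ℝ) : ℂ) + (Z1214 w 2 - bracket1214) * ((2 : ℤ) : ℂ)
        + (Z1214 w 3 - bracket1214) * (((3/2 : ℚ) : ℝ) : ℂ)) := by
  rw [e2star_eq_bracket]; unfold e2starW overPi
  have hp : (π : ℂ) ≠ 0 := by exact_mod_cast Real.pi_ne_zero
  push_cast
  field_simp
  ring

/-- box of `e2starW wLin − e₂*` [cite: Zhang2022LandauSiegel, (12.15)] -/
@[irreducible] def E15B : CB :=
  (CB.ofFI (overPiFI (125/63))).mul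
    ((((ZDB (1/2) (3/2) 2).mulFI (FI.ofRat (1/2))).add ((ZDB (-1/2) (1/2) 1).mulInt 2)).add
      ((ZDB (-3/2) (-1/2) 0).mulFI (FI.ofRat (3/2))))

/-- The certificate comparisons for (12.14)ⱼ (`normSq < 6.25·10⁻¹²`, i.e. `|·| < 2.5·10⁻⁶`) and (12.15)
(`normSq < 2.5·10⁻¹¹`, i.e. `|·| < 5·10⁻⁶`), linearised reading. [cite: Zhang2022LandauSiegel, (12.14), (12.15)] -/
def CertProp12Z : Prop :=
  (((ZDB (1/2) (3/2) 2).normSqFI.hi : ℚ) < (1/160000000000 : ℚ) * (SC : ℚ))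
  ∧ (((ZDB (-1/2) (1/2) 1).normSqFI.hi : ℚ) < (1/160000000000 : ℚ) * (SC : ℚ))
  ∧ (((ZDB (-3/2) (-1/2) 0).normSqFI.hi : ℚ) < (1/160000000000 : ℚ) * (SC : ℚ))
  ∧ ((E15B.normSqFI.hi : ℚ) < (1/40000000000 : ℚ) * (SC : ℚ))

/-- Decidability of the certificate comparisons. [folklore] -/
instance : Decidable CertProp12Z := by unfold CertProp12Z; infer_instance

/-- **The kernel check** ((12.14), (12.15), linearised). [cite: Zhang2022LandauSiegel, (12.14), (12.15)] -/
theorem cert12Z : CertProp12Z := by decide +kernel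

/-- From `normSq z < 6.25·10⁻¹²`: `‖z‖ < 10⁻⁵/4`. [folklore] -/
private theorem norm_lt_quarter {z : ℂ} (h : Complex.normSq z < ((1/160000000000 : ℚ) : ℝ)) : ‖z‖ < 1 / 10 ^ 5 / 4 := by
  have h0 : 0 ≤ ‖z‖ := norm_nonneg z
  rw [Complex.normSq_eq_norm_sq] at h
  have h2 : ((1/160000000000 : ℚ) : ℝ) = (1 / 10 ^ 5 / 4) ^ 2 := by norm_num
  rw [h2] at h
  exact lt_of_pow_lt_pow_left₀ 2 (by norm_num) h

/-- From `normSq z < 2.5·10⁻¹¹`: `‖z‖ < 10⁻⁵/2`. [folklore] -/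
private theorem norm_lt_half {z : ℂ} (h : Complex.normSq z < ((1/40000000000 : ℚ) : ℝ)) : ‖z‖ < 1 / 10 ^ 5 / 2 := by
  have h0 : 0 ≤ ‖z‖ := norm_nonneg z
  rw [Complex.normSq_eq_norm_sq] at h
  have h2 : ((1/40000000000 : ℚ) : ℝ) = (1 / 10 ^ 5 / 2) ^ 2 := by norm_num
  rw [h2] at h
  exact lt_of_pow_lt_pow_left₀ 2 (by norm_num) h

/-- the three `(I6, I7)` box memberships for `w = wLin` [cite: Zhang2022LandauSiegel, section 12 p.72] -/
theorem mem_windows_lin :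
    (CB.mem (I6 wLin 1) (WlinB (1/2) (3/2) 2 (1/500)) ∧ CB.mem (I7 wLin 1) (WlinB (3/2) (5/2) 2 (1/250)))
    ∧ (CB.mem (I6 wLin 2) (WlinB (-1/2) (3/2) 1 (1/500)) ∧ CB.mem (I7 wLin 2) (WlinB (1/2) (5/2) 1 (1/250)))
    ∧ (CB.mem (I6 wLin 3) (WlinB (-3/2) (3/2) 0 (1/500)) ∧ CB.mem (I7 wLin 3) (WlinB (-1/2) (5/2) 0 (1/250))) := by
  refine ⟨⟨?_, ?_⟩, ⟨?_, ?_⟩, ⟨?_, ?_⟩⟩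
  · rw [I6_lin_eq_one]; exact mem_WlinB flags6.1 flags6.2.1 flags6.2.2
  · rw [I7_lin_eq_one]; exact mem_WlinB flags7.1 flags7.2.1 flags7.2.2
  · rw [I6_lin_eq_two]; exact mem_WlinB flags6.1 flags6.2.1 flags6.2.2
  · rw [I7_lin_eq_two]; exact mem_WlinB flags7.1 flags7.2.1 flags7.2.2
  · rw [I6_lin_eq_three]; exact mem_WlinB flags6.1 flags6.2.1 flags6.2.2
  · rw [I7_lin_eq_three]; exact mem_WlinB flags7.1 flags7.2.1 flags7.2.2

/-- **(12.14), linearised reading, `j = 1`**: `|Z₁ − bracket| < 2.5·10⁻⁶` (value `2.11·10⁻⁶`). [cite: Zhang2022LandauSiegel, (12.14)] -/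
theorem eq1214_lin_one : Eq1214_num wLin 1 := by
  unfold Eq1214_num
  exact norm_lt_quarter (hi_bound (CB.mem_normSqFI (mem_ZDB mem_windows_lin.1.1 mem_windows_lin.1.2)) cert12Z.1)
/-- **(12.14), linearised, `j = 2`** (value `2.11·10⁻⁶`). [cite: Zhang2022LandauSiegel, (12.14)] -/
theorem eq1214_lin_two : Eq1214_num wLin 2 := by
  unfold Eq1214_num
  exact norm_lt_quarter (hi_bound (CB.mem_normSqFI (mem_ZDB mem_windows_lin.2.1.1 mem_windows_lin.2.1.2)) cert12Z.2.1)
/-- **(12.14), linearised, `j = 3`** (value `1.37·10⁻⁶`). [cite: Zhang2022LandauSiegel, (12.14)] -/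
theorem eq1214_lin_three : Eq1214_num wLin 3 := by
  unfold Eq1214_num
  exact norm_lt_quarter (hi_bound (CB.mem_normSqFI (mem_ZDB mem_windows_lin.2.2.1 mem_windows_lin.2.2.2)) cert12Z.2.2.1)

/-- **(12.15), linearised reading**: `|e2starW wLin − e₂*| < 5·10⁻⁶` (value `4.64·10⁻⁶`). [cite: Zhang2022LandauSiegel, (12.15)] -/
theorem eq1215_lin : Eq1215_num wLin := by
  unfold Eq1215_num
  have hU : overPiOK (125/63) = true := by decide +kernel
  have hm : CB.mem (e2starW wLin - e2star) E15B := by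
    rw [e2starW_sub]; unfold E15B
    exact CB.mem_mul (CB.mem_ofFI (mem_overPiFI hU))
      (CB.mem_add (CB.mem_add
        (CB.mem_mulFI (mem_ZDB mem_windows_lin.1.1 mem_windows_lin.1.2) (FI.mem_ofRat _))
        (CB.mem_mulInt (mem_ZDB mem_windows_lin.2.1.1 mem_windows_lin.2.1.2) 2))
        (CB.mem_mulFI (mem_ZDB mem_windows_lin.2.2.1 mem_windows_lin.2.2.2) (FI.mem_ofRat _)))
  exact norm_lt_half (hi_bound (CB.mem_normSqFI hm) cert12Z.2.2.2)

end Literature.NumberTheory.LFunctions.Zhang2022.Numerics
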